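import Summits.RiemannHypothesis.RiemannHypothesis.Theorems.GroundBartaEvenWinsBeyondArchDeflationPSD
import HarnessLib

/-!
# Motivic door / EXTREMISERS-B — soundness of the floating-Cholesky definiteness test `pd_certify`
# (the last paper step of the `rhdoor.extrem2.cert/1,2` and `rhdoor.extrem2.count/2,3` certificates)

pub-rhdoor (MOTIVIC-DOOR ticket), unit `extrem-2` (gen 4). HONEST FRAMING (verbatim): lottery ticket at the motivic door;
RH probability negligible; consolation prizes are real: a new semi-local Weil-positivity theorem, or a located gap
in the Connes–Consani programme, plus the ff-door theorem.

WHAT THIS FILE IS.  Every Arb certificate of `EXTREMISERS-B.md` §B.8/§B.11/§B.13/§B.14 bottoms out in ONE primitive,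
`wa_symeig.pd_certify` (pub-weilobs engine A): "every symmetric point matrix `B` of a ball matrix is positive definite".
Its paper proof (the code's docstring) is: take the exact midpoint minus a shift, `C = mid − δ·1` (up to a diagonal rounding
`≤ extra`), ANY matrix `R` (an approximate Cholesky factor of `C`), an entrywise enclosure `|RᵀR − C| ≤ U` with row sums `≤ β`,
and the radius budget `|B − mid| ≤ rad` with row sums `≤ ρ`; then `λ_min(B) ≥ δ − β − extra − ρ`.  This file PROVES that
inference for arbitrary real `k × k` data, in the sum language of the tree's deflated-Temple files: it is the composition of
`dt_quadForm_ge_of_ldl` (margin of `δ₀·1 + RᵀR`) and `dt_quadForm_nonneg_of_near` (row/column-sum perturbation budget,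
[cite: Rump2006PosDef, §2]) from `GroundBartaEvenWinsBeyondArchDeflationPSD` — no new idea, only the exact shape the
certificate code uses (two merged error sources `U` = residual enclosure, `V` = ball radii + diagonal rounding; conclusion
as a uniform lower bound of the quadratic form, `pdCertify_form_ge`, and as strict positivity, `pdCertify_form_pos`).
With it the dictionary of §B.13 has no step outside the kernel except the numerical EVALUATION of the hypotheses (Arb).

LABELS. PROVED (kernel-checked, no `sorry`, no axioms beyond the tree's; no definitions; RH-free, `ζ`-free).
References: S. M. Rump, Verification of positive definiteness, BIT 46 (2006) 433–452, §2 [Rump2006PosDef];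
N. J. Lehmann, Optimale Eigenwerteinschliessungen, Numer. Math. 5 (1963) 246–272 [Lehmann1963] (where the certified forms are used).
-/

set_option linter.dupNamespace false

noncomputable section

open Finset
open scoped BigOperators

namespace Summit.RiemannHypothesis.RiemannHypothesis.Theorems.MotivicDoor.PdCertify

open Summit.RiemannHypothesis.RiemannHypothesis.Theorems.EvenWinsBeyondArch

/-- the diagonal quadratic form: `Σ_i Σ_j α_i α_j (c·[i=j]) = c Σ_i α_i²`. [folklore] -/
theorem sum_sum_mul_diag {k : ℕ} (α : Fin k → ℝ) (c : ℝ) :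
    ∑ i, ∑ j, α i * α j * (c * (if i = j then 1 else 0)) = c * ∑ i, α i ^ 2 := by
  have : ∀ i : Fin k, ∑ j, α i * α j * (c * (if i = j then 1 else 0)) = c * α i ^ 2 := by
    intro i
    rw [Finset.sum_eq_single i]
    · simp; ring
    · intro j _ hji; simp [Ne.symm hji]
    · intro h; exact absurd (Finset.mem_univ i) h
  simp_rw [this, ← Finset.mul_sum]

/-- **Soundness of `pd_certify` (floating Cholesky + residual enclosure + radius budget).**
For a real `k × k` matrix `B` ("any symmetric point matrix of the ball matrix"), exact data `C` ("midpoint minus the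
shift `δ`", up to the diagonal rounding absorbed in `V`), ANY `m × k` matrix `R`, and nonnegative budgets:
if `|Σ_r R_ri R_rj − C_ij| ≤ U_ij` with all row and column sums of `U` at most `β`, and
`|B_ij − (C_ij + δ[i=j])| ≤ V_ij` with all row and column sums of `V` at most `ρ`, then
`(δ − β − ρ) Σ α_i² ≤ Σ_i Σ_j α_i α_j B_ij` for every `α`.  (`pd_certify` reports success iff `δ − β − ρ > 0`,
with its `extra + rho` playing the role of `ρ` here.) [cite: Rump2006PosDef, §2] -/
theorem pdCertify_form_ge {k m : ℕ} (B C U V : Fin k → Fin k → ℝ) (R : Fin m → Fin k → ℝ) (δ β ρ : ℝ)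
    (hRes : ∀ i j, |(∑ r, R r i * R r j) - C i j| ≤ U i j)
    (hUrow : ∀ i, ∑ j, U i j ≤ β) (hUcol : ∀ j, ∑ i, U i j ≤ β)
    (hB : ∀ i j, |B i j - (C i j + δ * (if i = j then 1 else 0))| ≤ V i j)
    (hVrow : ∀ i, ∑ j, V i j ≤ ρ) (hVcol : ∀ j, ∑ i, V i j ≤ ρ)
    (α : Fin k → ℝ) :
    (δ - β - ρ) * ∑ i, α i ^ 2 ≤ ∑ i, ∑ j, α i * α j * B i j := by
  -- M := B − (δ−β−ρ)·1,  P := (β+ρ)·1 + RᵀR,  E := U + V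
  set M : Fin k → Fin k → ℝ := fun i j => B i j - (δ - β - ρ) * (if i = j then 1 else 0) with hM
  set P : Fin k → Fin k → ℝ := fun i j => (β + ρ) * (if i = j then 1 else 0) + ∑ r, (1 : ℝ) * R r i * R r j with hP
  have hPform : ∀ γ : Fin k → ℝ, (β + ρ) * ∑ i, γ i ^ 2 ≤ ∑ i, ∑ j, γ i * γ j * P i j :=
    dt_quadForm_ge_of_ldl P (fun _ => (1 : ℝ)) R (β + ρ) (fun _ => zero_le_one) (fun i j => rfl)
  have hE : ∀ i j, |M i j - P i j| ≤ U i j + V i j := by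
    intro i j
    have h1 := hRes i j; have h2 := hB i j
    have hsum : (∑ r, (1 : ℝ) * R r i * R r j) = ∑ r, R r i * R r j := by simp
    have : M i j - P i j = (B i j - (C i j + δ * (if i = j then 1 else 0))) - ((∑ r, R r i * R r j) - C i j) := by
      simp only [hM, hP, hsum]; ring
    rw [this]
    calc |(B i j - (C i j + δ * (if i = j then 1 else 0))) - ((∑ r, R r i * R r j) - C i j)|
        ≤ |B i j - (C i j + δ * (if i = j then 1 else 0))| + |(∑ r, R r i * R r j) - C i j| := abs_sub _ _
      _ ≤ V i j + U i j := add_le_add h2 h1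
      _ = U i j + V i j := add_comm _ _
  have hrow : ∀ i, ∑ j, (U i j + V i j) ≤ β + ρ := fun i => by
    rw [Finset.sum_add_distrib]; exact add_le_add (hUrow i) (hVrow i)
  have hcol : ∀ j, ∑ i, (U i j + V i j) ≤ β + ρ := fun j => by
    rw [Finset.sum_add_distrib]; exact add_le_add (hUcol j) (hVcol j)
  have h0 : 0 ≤ ∑ i, ∑ j, α i * α j * M i j :=
    dt_quadForm_nonneg_of_near M P (fun i j => U i j + V i j) (β + ρ) hE hrow hcol hPform α
  have hsplit : ∑ i, ∑ j, α i * α j * M i j = (∑ i, ∑ j, α i * α j * B i j) - (δ - β - ρ) * ∑ i, α i ^ 2 := by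
    rw [← sum_sum_mul_diag α (δ - β - ρ), ← Finset.sum_sub_distrib]
    refine Finset.sum_congr rfl fun i _ => ?_
    rw [← Finset.sum_sub_distrib]
    refine Finset.sum_congr rfl fun j _ => ?_
    simp only [hM]; ring
  linarith [h0, hsplit]

/-- Strict form: a positive certified margin makes the quadratic form of `B` positive definite (in sum language:
positive at every `α ≠ 0`). [cite: Rump2006PosDef, §2] -/
theorem pdCertify_form_pos {k m : ℕ} (B C U V : Fin k → Fin k → ℝ) (R : Fin m → Fin k → ℝ) (δ β ρ : ℝ)
    (hRes : ∀ i j, |(∑ r, R r i * R r j) - C i j| ≤ U i j)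
    (hUrow : ∀ i, ∑ j, U i j ≤ β) (hUcol : ∀ j, ∑ i, U i j ≤ β)
    (hB : ∀ i j, |B i j - (C i j + δ * (if i = j then 1 else 0))| ≤ V i j)
    (hVrow : ∀ i, ∑ j, V i j ≤ ρ) (hVcol : ∀ j, ∑ i, V i j ≤ ρ)
    (hmargin : 0 < δ - β - ρ) (α : Fin k → ℝ) (hα : α ≠ 0) :
    0 < ∑ i, ∑ j, α i * α j * B i j := by
  have hsq : 0 < ∑ i, α i ^ 2 := by
    obtain ⟨i, hi⟩ : ∃ i, α i ≠ 0 := Function.ne_iff.mp hα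
    exact lt_of_lt_of_le (by positivity : 0 < α i ^ 2)
      (Finset.single_le_sum (fun j _ => sq_nonneg (α j)) (Finset.mem_univ i))
  exact lt_of_lt_of_le (mul_pos hmargin hsq) (pdCertify_form_ge B C U V R δ β ρ hRes hUrow hUcol hB hVrow hVcol α)

/-- The same bound as a uniform LOWER BOUND OF THE FORM shifted by a parameter `β₀` — the shape in which the
(count) certificates (`countcert.py`, rank-`q` update) and hypothesis `(L)` of `MotivicDoorLehmannGoerisch` consume it:
`pd_certify (B − β₀·1 + …)` with margin `> 0` gives `β₀ Σ α² ≤ ααB + …`; here the pure statement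
`c Σα² ≤ ααB` from a certificate for `B − c·1`. [cite: Rump2006PosDef, §2] -/
theorem form_ge_of_pdCertify_shift {k m : ℕ} (B C U V : Fin k → Fin k → ℝ) (R : Fin m → Fin k → ℝ) (c δ β ρ : ℝ)
    (hRes : ∀ i j, |(∑ r, R r i * R r j) - C i j| ≤ U i j)
    (hUrow : ∀ i, ∑ j, U i j ≤ β) (hUcol : ∀ j, ∑ i, U i j ≤ β)
    (hB : ∀ i j, |(B i j - c * (if i = j then 1 else 0)) - (C i j + δ * (if i = j then 1 else 0))| ≤ V i j)
    (hVrow : ∀ i, ∑ j, V i j ≤ ρ) (hVcol : ∀ j, ∑ i, V i j ≤ ρ)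
    (hmargin : 0 ≤ δ - β - ρ) (α : Fin k → ℝ) :
    c * ∑ i, α i ^ 2 ≤ ∑ i, ∑ j, α i * α j * B i j := by
  have h := pdCertify_form_ge (fun i j => B i j - c * (if i = j then 1 else 0)) C U V R δ β ρ hRes hUrow hUcol hB hVrow hVcol α
  have hsplit : ∑ i, ∑ j, α i * α j * (B i j - c * (if i = j then 1 else 0))
      = (∑ i, ∑ j, α i * α j * B i j) - c * ∑ i, α i ^ 2 := by
    rw [← sum_sum_mul_diag α c, ← Finset.sum_sub_distrib]
    refine Finset.sum_congr rfl fun i _ => ?_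
    rw [← Finset.sum_sub_distrib]
    refine Finset.sum_congr rfl fun j _ => ?_
    ring
  have hnn : 0 ≤ (δ - β - ρ) * ∑ i, α i ^ 2 := mul_nonneg hmargin (Finset.sum_nonneg fun i _ => sq_nonneg (α i))
  linarith [h, hsplit, hnn]

end Summit.RiemannHypothesis.RiemannHypothesis.Theorems.MotivicDoor.PdCertify

end
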